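import Summits.KontsevichZagierPeriods.KontsevichZagierPeriods.Theorems.LinRedNormalFormArrangementNormalFormSeparateTwoComparison

/-!
# Fibre-mass comparison with per-fibre constants and lower bounds

(Line `janus-bands`, crux `ArrangementNormalForm`, stub `stub_separateTwo`, part `ComparisonGain`.)
Two refinements of the comparison lemma `SepTwo.lmass_comp_le` with the same change-of-variables
proof. (1) GAIN (`lmass_comp_le_gain`, registered as `separateTwo_comparison_gain`): the bound
`mass(ψ ∘ α) ≤ (∏ᵢ Mᵢ) · mass(α)` with one constant `Mᵢ` per fibre, where `Mᵢ` only has to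
dominate the slope `ψ'(tᵢ)` (unlettered fibre) resp. the ratio `ψ'(tᵢ)|tᵢ − α c|/|ψ tᵢ − ψ(α c)|`
(fibre with letter `c`) at points `t` OF THE CELL of `α`; a fibre confined by its bounds to a core
contracted by the factor `s`, with a far letter or none, thus contributes `Mᵢ = O(s)` — the
polynomial gain of the fibre mass at a degenerating edge of the base polygon. (2) LOWER BOUND
(`setLIntegral_le_lmass_comp`): `(∏ᵢ mᵢ) · ∫_A (letter block of α) ≤ mass(ψ ∘ α)` for every
measurable `A ⊆ cell(α)` on which the slopes resp. ratios are at least `mᵢ`. Together they pin the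
vanishing order of the fibre mass at a degenerating edge to the number of confined far-lettered
fibres (roadmap for `stub_separateTwo`, touching-vertex-on-a-polar-edge case).
-/

noncomputable section

open Set MeasureTheory
open scoped ENNReal

namespace Summit.KontsevichZagierPeriods.ArrangementNormalForm.JanusBands

namespace SepTwo

variable {k : ℕ} {ι : Type*}

/-- A strictly increasing coordinatewise map sends the cell of `α` into the cell of `ψ ∘ α`. -/
theorem cw_mem_cell (lo hi : Fin k → Fin k ⊕ ι) (α : ι → ℝ) {ψ : ℝ → ℝ} (hmono : StrictMono ψ)
    {t : Fin k → ℝ} (ht : t ∈ cell lo hi α) : cw ψ t ∈ cell lo hi (ψ ∘ α) := by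
  intro i
  obtain ⟨h1, h2⟩ := ht i
  constructor
  · revert h1
    cases lo i with
    | inl j => intro h1; simpa [cw] using hmono h1
    | inr c => intro h1; simpa [cw] using hmono h1
  · revert h2
    cases hi i with
    | inl j => intro h2; simpa [cw] using hmono h2
    | inr c => intro h2; simpa [cw] using hmono h2

/-- Pointwise comparison of the transformed letter block, one constant per fibre. -/
theorem jac_mul_lblock_le_gain (a : Fin k → Option ι) (α : ι → ℝ) {ψ ψ' : ℝ → ℝ} (Mv : Fin k → ℝ)
    (hM : ∀ i, 0 ≤ Mv i) (hmono : StrictMono ψ) (t : Fin k → ℝ) (h0 : ∀ i, 0 ≤ ψ' (t i))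
    (h1 : ∀ i, a i = none → ψ' (t i) ≤ Mv i)
    (h2 : ∀ i c, a i = some c → ψ' (t i) * |t i - α c| ≤ Mv i * |ψ (t i) - ψ (α c)|) :
    ENNReal.ofReal |∏ i, ψ' (t i)| * lblock a (ψ ∘ α) (cw ψ t) ≤
      (∏ i, ENNReal.ofReal (Mv i)) * lblock a α t := by
  have hprod : |∏ i, ψ' (t i)| = ∏ i, ψ' (t i) := abs_of_nonneg (Finset.prod_nonneg fun i _ => h0 i)
  rw [hprod, ENNReal.ofReal_prod_of_nonneg fun i _ => h0 i]
  unfold lblock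
  rw [← Finset.prod_mul_distrib, ← Finset.prod_mul_distrib]
  refine Finset.prod_le_prod' fun i _ => ?_
  rcases hai : a i with _ | c
  · simpa using ENNReal.ofReal_le_ofReal (h1 i hai)
  · simp only [Option.elim_some, cw, Function.comp_apply]
    rw [← ENNReal.ofReal_mul (h0 i), ← ENNReal.ofReal_mul (hM i)]
    refine ENNReal.ofReal_le_ofReal ?_
    by_cases hti : t i = α c
    · rw [hti]; simp
    · have hne : ψ (t i) ≠ ψ (α c) := fun h => hti (hmono.injective h)
      rw [← div_eq_mul_inv, ← div_eq_mul_inv,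
        div_le_div_iff₀ (abs_pos.2 (sub_ne_zero.2 hne)) (abs_pos.2 (sub_ne_zero.2 hti))]
      exact h2 i c hai

/-- Pointwise lower comparison of the transformed letter block, one constant per fibre. -/
theorem le_jac_mul_lblock (a : Fin k → Option ι) (α : ι → ℝ) {ψ ψ' : ℝ → ℝ} (mv : Fin k → ℝ)
    (hm : ∀ i, 0 ≤ mv i) (hmono : StrictMono ψ) (t : Fin k → ℝ) (h0 : ∀ i, 0 ≤ ψ' (t i))
    (g1 : ∀ i, a i = none → mv i ≤ ψ' (t i))
    (g2 : ∀ i c, a i = some c → mv i * |ψ (t i) - ψ (α c)| ≤ ψ' (t i) * |t i - α c|) :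
    (∏ i, ENNReal.ofReal (mv i)) * lblock a α t ≤
      ENNReal.ofReal |∏ i, ψ' (t i)| * lblock a (ψ ∘ α) (cw ψ t) := by
  have hprod : |∏ i, ψ' (t i)| = ∏ i, ψ' (t i) := abs_of_nonneg (Finset.prod_nonneg fun i _ => h0 i)
  rw [hprod, ENNReal.ofReal_prod_of_nonneg fun i _ => h0 i]
  unfold lblock
  rw [← Finset.prod_mul_distrib, ← Finset.prod_mul_distrib]
  refine Finset.prod_le_prod' fun i _ => ?_
  rcases hai : a i with _ | c
  · simpa using ENNReal.ofReal_le_ofReal (g1 i hai)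
  · simp only [Option.elim_some, cw, Function.comp_apply]
    rw [← ENNReal.ofReal_mul (h0 i), ← ENNReal.ofReal_mul (hm i)]
    refine ENNReal.ofReal_le_ofReal ?_
    by_cases hti : t i = α c
    · rw [hti]; simp
    · have hne : ψ (t i) ≠ ψ (α c) := fun h => hti (hmono.injective h)
      rw [← div_eq_mul_inv, ← div_eq_mul_inv,
        div_le_div_iff₀ (abs_pos.2 (sub_ne_zero.2 hti)) (abs_pos.2 (sub_ne_zero.2 hne))]
      exact g2 i c hai

/-- The off-grid part of a set is measurable relative to it. -/
theorem measurableSet_offGrid (B : Finset ℝ) :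
    MeasurableSet {t : Fin k → ℝ | ∀ i, t i ∉ (B : Set ℝ)} := by
  have : {t : Fin k → ℝ | ∀ i, t i ∉ (B : Set ℝ)} = ⋂ i, (fun t => t i) ⁻¹' (B : Set ℝ)ᶜ := by
    ext t; simp
  rw [this]
  exact MeasurableSet.iInter fun i => (measurable_pi_apply i) B.measurableSet.compl

/-- **Comparison lemma with gain.** See the module docstring. -/
theorem lmass_comp_le_gain (lo hi : Fin k → Fin k ⊕ ι) (a : Fin k → Option ι) (α : ι → ℝ)
    {ψ ψ' : ℝ → ℝ} (B : Finset ℝ) (Mv : Fin k → ℝ) (hM : ∀ i, 0 ≤ Mv i) (hmono : StrictMono ψ)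
    (hsurj : Function.Surjective ψ) (hderiv : ∀ x, x ∉ (B : Set ℝ) → HasDerivAt ψ (ψ' x) x)
    (h0 : ∀ x, x ∉ (B : Set ℝ) → 0 ≤ ψ' x)
    (h1 : ∀ t ∈ cell lo hi α, ∀ i, t i ∉ (B : Set ℝ) → a i = none → ψ' (t i) ≤ Mv i)
    (h2 : ∀ t ∈ cell lo hi α, ∀ i c, t i ∉ (B : Set ℝ) → a i = some c →
      ψ' (t i) * |t i - α c| ≤ Mv i * |ψ (t i) - ψ (α c)|) :
    lmass lo hi a (ψ ∘ α) ≤ (∏ i, ENNReal.ofReal (Mv i)) * lmass lo hi a α := by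
  classical
  set S := cell lo hi α ∩ {t | ∀ i, t i ∉ (B : Set ℝ)} with hS_def
  set N := {t : Fin k → ℝ | ∃ i, t i ∈ ((B.image ψ : Finset ℝ) : Set ℝ)} with hN_def
  have hS : MeasurableSet S := (measurableSet_cell lo hi α).inter (measurableSet_offGrid B)
  have hN : volume N = 0 := volume_grid_eq_zero _
  have hdS : ∀ t ∈ S, HasFDerivWithinAt (cw ψ) (cwD ψ' t) S t := fun t ht =>
    (hasFDerivAt_cw fun i => hderiv _ (ht.2 i)).hasFDerivWithinAt
  have hinj : InjOn (cw ψ) S := fun t₁ _ t₂ _ h => funext fun i => hmono.injective (congr_fun h i)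
  have hcov := lintegral_image_eq_lintegral_abs_det_fderiv_mul volume hS hdS hinj (lblock a (ψ ∘ α))
  have htop : (∏ i, ENNReal.ofReal (Mv i)) ≠ ⊤ :=
    ENNReal.prod_ne_top fun i _ => ENNReal.ofReal_ne_top
  calc lmass lo hi a (ψ ∘ α)
      ≤ ∫⁻ t in cw ψ '' S ∪ N, lblock a (ψ ∘ α) t :=
        lintegral_mono_set (cell_comp_subset lo hi α hmono hsurj B)
    _ ≤ (∫⁻ t in cw ψ '' S, lblock a (ψ ∘ α) t) + ∫⁻ t in N, lblock a (ψ ∘ α) t :=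
        lintegral_union_le _ _ _
    _ = ∫⁻ t in cw ψ '' S, lblock a (ψ ∘ α) t := by rw [setLIntegral_measure_zero N _ hN, add_zero]
    _ = ∫⁻ t in S, ENNReal.ofReal |(cwD ψ' t).det| * lblock a (ψ ∘ α) (cw ψ t) := hcov
    _ ≤ ∫⁻ t in S, (∏ i, ENNReal.ofReal (Mv i)) * lblock a α t := by
        refine setLIntegral_mono' hS fun t ht => ?_
        rw [det_cwD]
        exact jac_mul_lblock_le_gain a α Mv hM hmono t (fun i => h0 _ (ht.2 i))
          (fun i hi => h1 t ht.1 i (ht.2 i) hi) fun i c hc => h2 t ht.1 i c (ht.2 i) hc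
    _ = (∏ i, ENNReal.ofReal (Mv i)) * ∫⁻ t in S, lblock a α t := lintegral_const_mul' _ _ htop
    _ ≤ (∏ i, ENNReal.ofReal (Mv i)) * lmass lo hi a α :=
        mul_le_mul_right (lintegral_mono_set inter_subset_left) _

/-- **Lower comparison on a sub-cell.** See the module docstring. -/
theorem setLIntegral_le_lmass_comp (lo hi : Fin k → Fin k ⊕ ι) (a : Fin k → Option ι) (α : ι → ℝ)
    {ψ ψ' : ℝ → ℝ} (B : Finset ℝ) (A : Set (Fin k → ℝ)) (hA : A ⊆ cell lo hi α)
    (hAm : MeasurableSet A) (mv : Fin k → ℝ) (hm : ∀ i, 0 ≤ mv i) (hmono : StrictMono ψ)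
    (hderiv : ∀ x, x ∉ (B : Set ℝ) → HasDerivAt ψ (ψ' x) x)
    (h0 : ∀ x, x ∉ (B : Set ℝ) → 0 ≤ ψ' x)
    (g1 : ∀ t ∈ A, ∀ i, t i ∉ (B : Set ℝ) → a i = none → mv i ≤ ψ' (t i))
    (g2 : ∀ t ∈ A, ∀ i c, t i ∉ (B : Set ℝ) → a i = some c →
      mv i * |ψ (t i) - ψ (α c)| ≤ ψ' (t i) * |t i - α c|) :
    (∏ i, ENNReal.ofReal (mv i)) * ∫⁻ t in A, lblock a α t ≤ lmass lo hi a (ψ ∘ α) := by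
  classical
  set S := A ∩ {t | ∀ i, t i ∉ (B : Set ℝ)} with hS_def
  set N := {t : Fin k → ℝ | ∃ i, t i ∈ (B : Set ℝ)} with hN_def
  have hS : MeasurableSet S := hAm.inter (measurableSet_offGrid B)
  have hN : volume N = 0 := volume_grid_eq_zero _
  have hAS : A ⊆ S ∪ N := fun t ht => by
    by_cases hB : ∀ i, t i ∉ (B : Set ℝ)
    · exact Or.inl ⟨ht, hB⟩
    · push Not at hB; exact Or.inr hB
  have hdS : ∀ t ∈ S, HasFDerivWithinAt (cw ψ) (cwD ψ' t) S t := fun t ht =>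
    (hasFDerivAt_cw fun i => hderiv _ (ht.2 i)).hasFDerivWithinAt
  have hinj : InjOn (cw ψ) S := fun t₁ _ t₂ _ h => funext fun i => hmono.injective (congr_fun h i)
  have hcov := lintegral_image_eq_lintegral_abs_det_fderiv_mul volume hS hdS hinj (lblock a (ψ ∘ α))
  have htop : (∏ i, ENNReal.ofReal (mv i)) ≠ ⊤ :=
    ENNReal.prod_ne_top fun i _ => ENNReal.ofReal_ne_top
  have hSub : cw ψ '' S ⊆ cell lo hi (ψ ∘ α) := by
    rintro _ ⟨t, ht, rfl⟩; exact cw_mem_cell lo hi α hmono (hA ht.1)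
  calc (∏ i, ENNReal.ofReal (mv i)) * ∫⁻ t in A, lblock a α t
      ≤ (∏ i, ENNReal.ofReal (mv i)) * ∫⁻ t in S ∪ N, lblock a α t :=
        mul_le_mul_right (lintegral_mono_set hAS) _
    _ ≤ (∏ i, ENNReal.ofReal (mv i)) * ((∫⁻ t in S, lblock a α t) + ∫⁻ t in N, lblock a α t) :=
        mul_le_mul_right (lintegral_union_le _ _ _) _
    _ = (∏ i, ENNReal.ofReal (mv i)) * ∫⁻ t in S, lblock a α t := by
        rw [setLIntegral_measure_zero N _ hN, add_zero]
    _ = ∫⁻ t in S, (∏ i, ENNReal.ofReal (mv i)) * lblock a α t := (lintegral_const_mul' _ _ htop).symm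
    _ ≤ ∫⁻ t in S, ENNReal.ofReal |(cwD ψ' t).det| * lblock a (ψ ∘ α) (cw ψ t) := by
        refine setLIntegral_mono' hS fun t ht => ?_
        rw [det_cwD]
        exact le_jac_mul_lblock a α mv hm hmono t (fun i => h0 _ (ht.2 i))
          (fun i hi => g1 t ht.1 i (ht.2 i) hi) fun i c hc => g2 t ht.1 i c (ht.2 i) hc
    _ = ∫⁻ t in cw ψ '' S, lblock a (ψ ∘ α) t := hcov.symm
    _ ≤ lmass lo hi a (ψ ∘ α) := lintegral_mono_set hSub

end SepTwo

/-- **Fibre-mass comparison with per-fibre gain** (registered sub-goal of `stub_separateTwo`;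
literal form of `SepTwo.lmass_comp_le_gain`): as `separateTwo_comparison`, but with one constant
`Mv i` per fibre, required to dominate the slope (unlettered fibre) resp. the ratio (lettered
fibre) only at the points of the cell of `α` off the grid over `B`. -/
theorem separateTwo_comparison_gain (k : ℕ) (ι : Type) (lo hi : Fin k → Fin k ⊕ ι) (a : Fin k → Option ι) (α : ι → ℝ) (ψ ψ' : ℝ → ℝ) (B : Finset ℝ) (Mv : Fin k → ℝ) (hM : ∀ i, 0 ≤ Mv i) (hmono : StrictMono ψ) (hsurj : Function.Surjective ψ) (hderiv : ∀ x, x ∉ (B : Set ℝ) → HasDerivAt ψ (ψ' x) x) (h0 : ∀ x, x ∉ (B : Set ℝ) → 0 ≤ ψ' x) (h1 : ∀ t ∈ {t : Fin k → ℝ | ∀ i, Sum.elim t α (lo i) < t i ∧ t i < Sum.elim t α (hi i)}, ∀ i, t i ∉ (B : Set ℝ) → a i = none → ψ' (t i) ≤ Mv i) (h2 : ∀ t ∈ {t : Fin k → ℝ | ∀ i, Sum.elim t α (lo i) < t i ∧ t i < Sum.elim t α (hi i)}, ∀ i c, t i ∉ (B : Set ℝ) → a i = some c → ψ' (t i) *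 |t i - α c| ≤ Mv i * |ψ (t i) - ψ (α c)|) : MeasureTheory.lintegral (MeasureTheory.volume.restrict {t : Fin k → ℝ | ∀ i, Sum.elim t (fun c => ψ (α c)) (lo i) < t i ∧ t i < Sum.elim t (fun c => ψ (α c)) (hi i)}) (fun t => ∏ i, (a i).elim 1 (fun c => ENNReal.ofReal |t i - ψ (α c)|⁻¹)) ≤ (∏ i, ENNReal.ofReal (Mv i)) * MeasureTheory.lintegral (MeasureTheory.volume.restrict {t : Fin k → ℝ | ∀ i, Sum.elim t α (lo i) < t i ∧ t i < Sum.elim t α (hi i)}) (fun t => ∏ i, (a i).elim 1 (fun c => ENNReal.ofReal |t i - α c|⁻¹)) := by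
  exact SepTwo.lmass_comp_le_gain lo hi a α B Mv hM hmono hsurj hderiv h0 h1 h2

end Summit.KontsevichZagierPeriods.ArrangementNormalForm.JanusBands
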